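import Summits.Ventures.PercRepro.Conditioning
import Summits.Ventures.PercRepro.Coupling
import Summits.Ventures.PercRepro.Classical
import Summits.Ventures.PercRepro.DecisionTree

/-!
# The Harris–Kleitman inequality for decision trees (Gladkov, Theorem 3.2)

For a decision tree `t` (`DecisionTree.lean`) building the edge set `S = run t ω ω'` from two
independent configurations, and increasing events `A`, `B`:
`P(ω ∈ A ∧ ω →_S ω' ∈ B) ≥ P(A) · P(B)` (Gladkov, *Percolation inequalities and decision
trees*, arXiv:2408.08457, Theorem 3.2; `S = E` is the Harris inequality, `S = ∅` independence).

Proof by structural induction on the tree (`DTree.hk_aux`), generalised to two weight vectors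
`p₁, p₂` for the two copies that agree off the set `Q` of already queried edges, and a set
`S₀ ⊆ Q` of the queried edges already sent to `S`:
`P_{p₁}(A) · E[1_B(ω →_{S₀} ω')] ≤ E[1_A(ω) · 1_B(ω →_{S₀ ∪ S} ω')]`.
At a leaf this is the Harris inequality for the two increasing functions `1_A(ω)`,
`1_B(ω →_{S₀} ω')` of the pair, i.e. Harris on `Config (E ⊕ E)` (`expectPair_harris_mix`, from
typer-2's `harris` and typer-1's product law).  At a node querying `e` the two-copy expectation
splits along `e` in both copies (`expectPair_split`); on each cell the subtree gives the inductive
bound, whose `B`-factor is `n(b) = E[1_B((ω →_{S₀} ω')[e := b])]` with `b` the state of `e` in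
the copy the node's decision selects (`expectPair_upd_eq`: fixing `e` does not change the
expectation of a function that does not look at `e`).  An edge sent to `S` pairs the two
increasing functions `b ↦ P_{p₁[e:=b]}(A)` and `b ↦ n(b)` of the SAME bit — the two-point
Chebyshev inequality (`chebyshev_two_point`); an edge sent to `Sᶜ` pairs independent bits — an
exact product.  Main results: `DTree.hk_aux`, **`DTree.hk`**.

Part A of `DecisionTreeHK` (split for the ≤ 400-line lint; proofs byte-identical) — the last part `DecisionTreeHK.lean` imports it.
-/

namespace PercRepro

open Finset

variable {E : Type*}

/-! ### Fixing one edge: Bernoulli factors and the updated weight vectors -/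

variable [DecidableEq E]

/-- The Bernoulli factor of an edge. -/
def cf (p : E → ℝ) (e : E) (b : Bool) : ℝ := if b then p e else 1 - p e

/-- `p[e := b]` as a weight vector. -/
noncomputable def upd (p : E → ℝ) (e : E) (b : Bool) : E → ℝ :=
  Function.update p e (if b then 1 else 0)

/-- `upd p e true = p[e := 1]`. -/
theorem upd_true (p : E → ℝ) (e : E) : upd p e true = Function.update p e 1 := rfl

/-- `upd p e false = p[e := 0]`. -/
theorem upd_false (p : E → ℝ) (e : E) : upd p e false = Function.update p e 0 := rfl

/-- `p[e := b]` is a probability vector. -/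
theorem isProb_upd {p : E → ℝ} (hp : IsProb p) (e : E) (b : Bool) : IsProb (upd p e b) := by
  cases b
  · rw [upd_false]; exact hp.update e ⟨le_refl (0 : ℝ), zero_le_one⟩
  · rw [upd_true]; exact hp.update e ⟨zero_le_one, le_refl (1 : ℝ)⟩


variable [Fintype E]

/-- The one-edge splitting identity in Boolean form. -/
theorem weight_eq_sum_cf (p : E → ℝ) (e : E) (ω : Config E) :
    weight p ω = ∑ b : Bool, cf p e b * weight (upd p e b) ω := by
  rw [weight_split p e ω, Fintype.sum_bool, upd_true, upd_false]
  simp only [cf, if_true, Bool.false_eq_true, if_false, add_comm]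

/-- Under `p[e := b]` the edge `e` surely has state `b`. -/
theorem eq_of_weight_upd_ne_zero {p : E → ℝ} {e : E} {b : Bool} {ω : Config E}
    (h : weight (upd p e b) ω ≠ 0) : ω e = b := by
  cases b with
  | true =>
    rw [upd_true, weight_update_one] at h
    by_contra hc
    simp [hc] at h
  | false =>
    rw [upd_false, weight_update_zero] at h
    by_contra hc
    simp [hc] at h

/-- `P_p(A) = Σ_b cf p e b · P_{p[e:=b]}(A)`. -/
theorem prob_eq_sum_cf (p : E → ℝ) (e : E) (A : Set (Config E)) :
    prob p A = ∑ b : Bool, cf p e b * prob (upd p e b) A := by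
  rw [prob_split p e A, Fintype.sum_bool, upd_true, upd_false]
  simp only [cf, if_true, Bool.false_eq_true, if_false, add_comm]

/-! ### Two-copy expectations -/

/-- The expectation of `F` over two independent configurations with laws `p₁`, `p₂`. -/
noncomputable def expectPair (p₁ p₂ : E → ℝ) (F : Config E → Config E → ℝ) : ℝ :=
  ∑ ω, ∑ ω', weight p₁ ω * weight p₂ ω' * F ω ω'

/-- Two-copy expectations only see the supports. -/
theorem expectPair_congr {p₁ p₂ : E → ℝ} {F G : Config E → Config E → ℝ}
    (h : ∀ ω ω', weight p₁ ω ≠ 0 → weight p₂ ω' ≠ 0 → F ω ω' = G ω ω') :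
    expectPair p₁ p₂ F = expectPair p₁ p₂ G := by
  unfold expectPair
  refine Finset.sum_congr rfl fun ω _ => Finset.sum_congr rfl fun ω' _ => ?_
  by_cases h1 : weight p₁ ω = 0
  · simp [h1]
  by_cases h2 : weight p₂ ω' = 0
  · simp [h2]
  rw [h ω ω' h1 h2]

/-- Splitting a two-copy expectation along the edge `e` in both copies. -/
theorem sum_weight_mul_eq_sum_cf (p : E → ℝ) (e : E) (g : Config E → ℝ) :
    ∑ ω, weight p ω * g ω = ∑ b : Bool, cf p e b * ∑ ω, weight (upd p e b) ω * g ω := by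
  simp only [Finset.mul_sum]
  rw [Finset.sum_comm]
  refine Finset.sum_congr rfl fun ω _ => ?_
  rw [weight_eq_sum_cf p e ω, Finset.sum_mul]
  refine Finset.sum_congr rfl fun b _ => ?_
  ring

/-- Splitting a two-copy expectation along the edge `e` in both copies. -/
theorem expectPair_split (p₁ p₂ : E → ℝ) (e : E) (F : Config E → Config E → ℝ) :
    expectPair p₁ p₂ F =
      ∑ b : Bool, ∑ b' : Bool, cf p₁ e b * cf p₂ e b' * expectPair (upd p₁ e b) (upd p₂ e b') F := by
  unfold expectPair
  have h1 : ∀ (q₁ q₂ : E → ℝ) (ω : Config E), ∑ ω', weight q₁ ω * weight q₂ ω' * F ω ω' =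
      weight q₁ ω * ∑ ω', weight q₂ ω' * F ω ω' := by
    intro q₁ q₂ ω
    rw [Finset.mul_sum]
    refine Finset.sum_congr rfl fun ω' _ => by ring
  simp only [h1]
  rw [sum_weight_mul_eq_sum_cf p₁ e]
  refine Finset.sum_congr rfl fun b _ => ?_
  have h2 : ∀ ω, ∑ ω', weight p₂ ω' * F ω ω' =
      ∑ b' : Bool, cf p₂ e b' * ∑ ω', weight (upd p₂ e b') ω' * F ω ω' :=
    fun ω => sum_weight_mul_eq_sum_cf p₂ e (F ω)
  simp only [h2, Finset.mul_sum]
  rw [Finset.sum_comm]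
  refine Finset.sum_congr rfl fun b' _ => ?_
  refine Finset.sum_congr rfl fun ω _ => ?_
  refine Finset.sum_congr rfl fun ω' _ => ?_
  ring

/-- The two-point Chebyshev inequality: for `c ∈ [0,1]` and increasing pairs `x₀ ≤ x₁`,
`y₀ ≤ y₁`, `(c x₁ + (1-c) x₀)(c y₁ + (1-c) y₀) ≤ c x₁ y₁ + (1-c) x₀ y₀`. -/
theorem chebyshev_two_point {c x₀ x₁ y₀ y₁ : ℝ} (hc0 : 0 ≤ c) (hc1 : c ≤ 1) (hx : x₀ ≤ x₁)
    (hy : y₀ ≤ y₁) :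
    (c * x₁ + (1 - c) * x₀) * (c * y₁ + (1 - c) * y₀) ≤ c * (x₁ * y₁) + (1 - c) * (x₀ * y₀) := by
  nlinarith [mul_nonneg (mul_nonneg hc0 (sub_nonneg.mpr hc1)) (mul_nonneg (sub_nonneg.mpr hx) (sub_nonneg.mpr hy))]

/-! ### Mixing lemmas -/

omit [DecidableEq E] [Fintype E] in
/-- `mix ∅ ω ω' = ω'`. -/
theorem mix_empty (ω ω' : Config E) : mix (∅ : Set E) ω ω' = ω' := by
  funext e
  exact mix_apply_of_notMem (Set.notMem_empty e) ω ω'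

omit [Fintype E] in
/-- Adding `e` to the mixing set overwrites `e` with the first configuration's state. -/
theorem mix_insert (S : Set E) (ω ω' : Config E) (e : E) :
    mix (insert e S) ω ω' = Function.update (mix S ω ω') e (ω e) := by
  funext e'
  by_cases h : e' = e
  · subst h
    rw [mix_apply_of_mem (Set.mem_insert _ _), Function.update_self]
  · rw [Function.update_of_ne h]
    by_cases hS : e' ∈ S
    · rw [mix_apply_of_mem (Set.mem_insert_of_mem _ hS), mix_apply_of_mem hS]
    · have : e' ∉ insert e S := by simp [h, hS]
      rw [mix_apply_of_notMem this, mix_apply_of_notMem hS]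

omit [DecidableEq E] [Fintype E] in
/-- `mix` is monotone in both configurations. -/
theorem mix_mono (S : Set E) {ω₁ ω₂ ω₁' ω₂' : Config E} (h : ω₁ ≤ ω₂) (h' : ω₁' ≤ ω₂') :
    mix S ω₁ ω₁' ≤ mix S ω₂ ω₂' := by
  intro e
  by_cases he : e ∈ S
  · rw [mix_apply_of_mem he, mix_apply_of_mem he]; exact h e
  · rw [mix_apply_of_notMem he, mix_apply_of_notMem he]; exact h' e

omit [Fintype E] in
/-- Overwriting `e` after mixing forgets the first configuration's state at `e`. -/
theorem update_mix_update_left (S : Set E) (ω ω' : Config E) (e : E) (x b : Bool) :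
    Function.update (mix S (Function.update ω e x) ω') e b = Function.update (mix S ω ω') e b := by
  funext e'
  by_cases h : e' = e
  · subst h; simp
  · rw [Function.update_of_ne h, Function.update_of_ne h]
    by_cases hS : e' ∈ S
    · rw [mix_apply_of_mem hS, mix_apply_of_mem hS, Function.update_of_ne h]
    · rw [mix_apply_of_notMem hS, mix_apply_of_notMem hS]

omit [Fintype E] in
/-- Overwriting `e` after mixing forgets the second configuration's state at `e`. -/
theorem update_mix_update_right (S : Set E) (ω ω' : Config E) (e : E) (x b : Bool) :
    Function.update (mix S ω (Function.update ω' e x)) e b = Function.update (mix S ω ω') e b := by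
  funext e'
  by_cases h : e' = e
  · subst h; simp
  · rw [Function.update_of_ne h, Function.update_of_ne h]
    by_cases hS : e' ∈ S
    · rw [mix_apply_of_mem hS, mix_apply_of_mem hS]
    · rw [mix_apply_of_notMem hS, mix_apply_of_notMem hS, Function.update_of_ne h]

omit [DecidableEq E] [Fintype E] in
/-- The Bernoulli factors of an edge sum to `1`. -/
theorem sum_cf (p : E → ℝ) (e : E) : ∑ b : Bool, cf p e b = 1 := by
  simp [cf]

/-! ### Functions that do not look at one edge -/

/-- A one-copy expectation of a function that does not look at `e` is the same under `p[e:=b]`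
for every `b`. -/
theorem sum_weight_upd_mul_eq {p : E → ℝ} {e : E} {h : Config E → ℝ}
    (hh : ∀ ω x, h (Function.update ω e x) = h ω) (b b' : Bool) :
    ∑ ω, weight (upd p e b) ω * h ω = ∑ ω, weight (upd p e b') ω * h ω := by
  -- both sides equal `∑ ω, weightErase p e ω * [ω e = true] * h ω` after the flip
  have key : ∀ b : Bool, ∑ ω, weight (upd p e b) ω * h ω =
      ∑ ω, (if ω e = true then weightErase p e ω else 0) * h ω := by
    intro b
    cases b with
    | true =>
      refine Finset.sum_congr rfl fun ω _ => ?_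
      rw [upd_true, weight_update_one]
    | false =>
      rw [← (flipEdge_involutive e).bijective.sum_comp]
      refine Finset.sum_congr rfl fun ω _ => ?_
      rw [upd_false, weight_update_zero, weightErase_flipEdge]
      have hfl : h (flipEdge e ω) = h ω := hh ω (!ω e)
      rw [hfl]
      by_cases hω : ω e = true
      · simp [flipEdge, hω]
      · simp [flipEdge, hω]
  rw [key b, key b']

/-- A two-copy expectation of a function that does not look at `e` in either copy is the same
under `(p₁[e:=b], p₂[e:=b'])` for every `b, b'`. -/
theorem expectPair_upd_eq {p₁ p₂ : E → ℝ} {e : E} {G : Config E → Config E → ℝ}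
    (h₁ : ∀ ω ω' x, G (Function.update ω e x) ω' = G ω ω')
    (h₂ : ∀ ω ω' x, G ω (Function.update ω' e x) = G ω ω') (b b' c c' : Bool) :
    expectPair (upd p₁ e b) (upd p₂ e b') G = expectPair (upd p₁ e c) (upd p₂ e c') G := by
  unfold expectPair
  have inner : ∀ (q : E → ℝ) (d : Bool) (ω : Config E),
      ∑ ω', weight q ω * weight (upd p₂ e d) ω' * G ω ω' =
        weight q ω * ∑ ω', weight (upd p₂ e c') ω' * G ω ω' := by
    intro q d ω
    rw [← sum_weight_upd_mul_eq (p := p₂) (e := e) (h := fun ω' => G ω ω')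
      (fun ω' x => h₂ ω ω' x) d c', Finset.mul_sum]
    exact Finset.sum_congr rfl fun ω' _ => by ring
  simp only [inner]
  exact sum_weight_upd_mul_eq (p := p₁) (e := e)
    (h := fun ω => ∑ ω', weight (upd p₂ e c') ω' * G ω ω')
    (fun ω x => Finset.sum_congr rfl fun ω' _ => by rw [h₁]) b c

/-! ### The base case: Harris on the product of the two copies -/

/-- A probability on `Config (E ⊕ E)` under the product law is a two-copy expectation. -/
theorem prob_sum_elim_eq_expectPair (p₁ p₂ : E → ℝ) (S' : Set (Config (E ⊕ E))) :
    prob (Sum.elim p₁ p₂) S' = expectPair p₁ p₂ (fun α β => S'.indicator 1 (Sum.elim α β)) := by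
  rw [prob_sum_elim]
  unfold expectPair
  refine Finset.sum_congr rfl fun α _ => ?_
  unfold prob
  rw [Finset.mul_sum]
  refine Finset.sum_congr rfl fun β _ => ?_
  dsimp only
  by_cases h : Sum.elim α β ∈ S'
  · have h' : β ∈ {β : Config E | Sum.elim α β ∈ S'} := h
    rw [Set.indicator_of_mem h', Set.indicator_of_mem h, Pi.one_apply, mul_one]
  · have h' : β ∉ {β : Config E | Sum.elim α β ∈ S'} := h
    rw [Set.indicator_of_notMem h', Set.indicator_of_notMem h, mul_zero, mul_zero]

/-- **Harris for the two copies**: for increasing `A`, `B` and any edge set `S`, the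
indicators `1_A(ω)` and `1_B(ω →_S ω')` are positively correlated under the product law. -/
theorem expectPair_harris_mix {p₁ p₂ : E → ℝ} (hp₁ : IsProb p₁) (hp₂ : IsProb p₂)
    {A B : Set (Config E)} (hA : IsUpperSet A) (hB : IsUpperSet B) (S : Set E) :
    prob p₁ A * expectPair p₁ p₂ (fun ω ω' => B.indicator 1 (mix S ω ω')) ≤
      expectPair p₁ p₂ (fun ω ω' => A.indicator 1 ω * B.indicator 1 (mix S ω ω')) := by
  set A' : Set (Config (E ⊕ E)) := {Ω | Ω ∘ Sum.inl ∈ A} with hA'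
  set B' : Set (Config (E ⊕ E)) := {Ω | mix S (Ω ∘ Sum.inl) (Ω ∘ Sum.inr) ∈ B} with hB'
  have hA'up : IsUpperSet A' := fun Ω Ω' h hΩ => hA (fun e => h (Sum.inl e)) hΩ
  have hB'up : IsUpperSet B' := fun Ω Ω' h hΩ =>
    hB (mix_mono S (fun e => h (Sum.inl e)) (fun e => h (Sum.inr e))) hΩ
  have h := harris (isProb_sum_elim hp₁ hp₂) hA'up hB'up
  rw [prob_left, prob_sum_elim_eq_expectPair, prob_sum_elim_eq_expectPair] at h
  have e1 : ∀ α β : Config E, B'.indicator (1 : Config (E ⊕ E) → ℝ) (Sum.elim α β) =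
      B.indicator 1 (mix S α β) := by
    intro α β
    by_cases hb : mix S α β ∈ B
    · have : Sum.elim α β ∈ B' := hb
      rw [Set.indicator_of_mem this, Set.indicator_of_mem hb]; rfl
    · have : Sum.elim α β ∉ B' := hb
      rw [Set.indicator_of_notMem this, Set.indicator_of_notMem hb]
  have e2 : ∀ α β : Config E, (A' ∩ B').indicator (1 : Config (E ⊕ E) → ℝ) (Sum.elim α β) =
      A.indicator 1 α * B.indicator 1 (mix S α β) := by
    intro α β
    by_cases ha : α ∈ A <;> by_cases hb : mix S α β ∈ B
    · have : Sum.elim α β ∈ A' ∩ B' := ⟨ha, hb⟩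
      rw [Set.indicator_of_mem this, Set.indicator_of_mem ha, Set.indicator_of_mem hb]; simp
    · have : Sum.elim α β ∉ A' ∩ B' := fun h' => hb h'.2
      rw [Set.indicator_of_notMem this, Set.indicator_of_notMem hb, mul_zero]
    · have : Sum.elim α β ∉ A' ∩ B' := fun h' => ha h'.1
      rw [Set.indicator_of_notMem this, Set.indicator_of_notMem ha, zero_mul]
    · have : Sum.elim α β ∉ A' ∩ B' := fun h' => ha h'.1
      rw [Set.indicator_of_notMem this, Set.indicator_of_notMem ha, zero_mul]
  simp only [e1, e2] at h
  exact h

end PercRepro
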